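import Literature.MathematicalPhysics.QuantumFieldTheory.SUNBakryEmeryPoincare
import Literature.MathematicalPhysics.QuantumFieldTheory.TiltedExponentMorseBounds
import HarnessLib

/-!
# Venture YMGap — the one-link Kantorovich–Rubinstein modulus beyond Bakry–Émery, part 1 (calculus on `SU(N)`)

HONEST FRAMING: venture file of the cell `pub-ymgap` (QuantumFields programme), strong-coupling LATTICE bookkeeping for
`SU(N)` lattice Yang–Mills; nothing about the continuum or the mass gap in the Clay sense.  This file and its sibling
`OneLinkEigenModulus` improve ONE constant: the Kantorovich–Rubinstein modulus `K` of the one-link Gibbs family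
`ν_B(dg) ∝ exp(N Re tr(g B)) dg` on `SU(N)` (the tree's hypothesis schema `OneLinkKRModulus N R K`), whose Bakry–Émery value
`K = 1/(1/2 − R)` (`oneLinkKRModulus_SU`) feeds every all-`N` row of the cell (star door, Dobrushin door, slab/area-law door).

METHOD (first order of a Laplacian-eigenfunction expansion).  The linear observable `u(Q) = Re tr(Q Δ)` is an eigenfunction of
the Laplace–Beltrami operator of `SU(N)`: `Δ u = −λ u`, `λ = N − 1/N` (Casimir of the fundamental representation,
`sum_frame_mul_frame`).  Hence `u = (Γ(S,u) − L_S u)/λ` for the Langevin generator `L_S = Δ + Γ(S,·)` of `ν_B`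
(`S = N Re tr(· B)`), and the covariance of any observable with `u` splits into an integration-by-parts term (no curvature) and
the covariance with the carré du champ `Γ(S,u)`, which is `N` times an explicit quadratic trace polynomial (Parseval identity of
the frame, `sum_trace_mul_smul_frame`):

  `Γ(Re tr(· B), Re tr(· Δ))(Q) = −½ Re tr(B Q Δ Q) + ½ Re tr(B Q (Δ Q)ᴴ) − (1/N) · Im tr(B Q) · Im tr(Δ Q)`,

whose Lipschitz constant on `SU(N)` for the Frobenius distance is at most `3 ‖B‖_op ‖Δ‖_F`, uniformly in `N` — the `1/N` in
front of the trace–trace term exactly compensates `‖B‖_F ≤ √N ‖B‖_op` and `‖Q‖_F = √N`.  This file proves these three facts;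
the sibling turns them into the modulus `K₁(N,R) = (N²/(N²−1)) · (1/2 + 2R)/(1/2 − R)`.

All differential calculus is the ambient calculus of `SUNBakryEmeryPoincare` (`matD`, `Gam`, `Lap`, `pot`, Parseval frame
`frame`).  References: H. Shen, R. Zhu, X. Zhu, CMP 400 (2023) 805–851 (arXiv:2204.12737), Lemma 4.1, Rem. 1.3 (the one-link
measure and the Dobrushin route); T. Bröcker, T. tom Dieck, GTM 98, IV (3.1) (Casimir); cell note `HOME/p2/ONE-LINK-MODULUS.md`.
-/

noncomputable section

open scoped Matrix ComplexConjugate BigOperators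
open Matrix Complex Finset
open Literature.MathematicalPhysics.QuantumFieldTheory
open Literature.MathematicalPhysics.QuantumFieldTheory.SUNBakryEmery

namespace Summit.Ventures.YMGap.OneLinkEigen

variable {N : ℕ}

/-! ### Traces: real parts against skew-Hermitian matrices, imaginary parts, Frobenius bounds -/

/-- For skew-Hermitian `Y`: `2 Re tr(Y P) = tr(Y (P − Pᴴ))` (as complex numbers). [folklore] -/
theorem two_mul_re_trace_eq {Y : Matrix (Fin N) (Fin N) ℂ} (hY : Yᴴ = -Y) (P : Matrix (Fin N) (Fin N) ℂ) :
    (2 : ℂ) * (((Y * P).trace.re : ℝ) : ℂ) = (Y * (P - Pᴴ)).trace := by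
  have h1 : Y * Pᴴ = -(P * Y)ᴴ := by rw [conjTranspose_mul, hY, neg_mul, neg_neg]
  have h2 : (Y * Pᴴ).trace = -conj ((Y * P).trace) := by
    rw [h1, trace_neg, trace_conjTranspose, trace_mul_comm P Y, star_def]
  rw [Matrix.mul_sub, trace_sub, h2, sub_neg_eq_add, add_conj, Complex.ofReal_mul]
  norm_num

/-- `Im tr(X Y) = Re tr((−i X) Y)`. [folklore] -/
theorem im_trace_mul_eq_re (X Y : Matrix (Fin N) (Fin N) ℂ) :
    (X * Y).trace.im = (((-I) • X) * Y).trace.re := by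
  rw [smul_mul_assoc, trace_smul, smul_eq_mul, mul_re, neg_re, neg_im, I_re, I_im]
  ring

/-- `|Im tr(X Y)| ≤ ‖X‖_F ‖Y‖_F`. [folklore] -/
theorem abs_im_trace_mul_le (X Y : Matrix (Fin N) (Fin N) ℂ) :
    |(X * Y).trace.im| ≤ frobNorm X * frobNorm Y := by
  rw [im_trace_mul_eq_re]
  have h := abs_re_trace_mul_le ((-I) • X) Y
  rwa [frobNorm_smul, norm_neg, norm_I, one_mul] at h

/-- `‖B‖_F ≤ √N ‖B‖_op` (`‖1‖_F = √N` is `OneLinkLaplace.frobNorm_one`). [folklore] -/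
theorem frobNorm_le_sqrt_mul_matrixOpNorm (B : Matrix (Fin N) (Fin N) ℂ) :
    frobNorm B ≤ Real.sqrt N * matrixOpNorm B := by
  have h := frobNorm_mul_le_matrixOpNorm_mul B (1 : Matrix (Fin N) (Fin N) ℂ)
  rwa [Matrix.mul_one, OneLinkLaplace.frobNorm_one, mul_comm] at h

/-- `|Im tr(B g)| ≤ N ‖B‖_op` on `SU(N)`. [folklore] -/
theorem abs_im_trace_mul_su_le (B : Matrix (Fin N) (Fin N) ℂ) (g : SUN N) :
    |(B * (g : Matrix (Fin N) (Fin N) ℂ)).trace.im| ≤ N * matrixOpNorm B := by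
  refine (abs_im_trace_mul_le _ _).trans ?_
  rw [frobNorm_su]
  calc frobNorm B * Real.sqrt N ≤ Real.sqrt N * matrixOpNorm B * Real.sqrt N :=
        mul_le_mul_of_nonneg_right (frobNorm_le_sqrt_mul_matrixOpNorm B) (Real.sqrt_nonneg _)
    _ = N * matrixOpNorm B := by
        rw [mul_comm, ← mul_assoc, Real.mul_self_sqrt (Nat.cast_nonneg N)]

/-- `|Im tr(D g)| ≤ √N ‖D‖_F` on `SU(N)`. [folklore] -/
theorem abs_im_trace_mul_su_le' (D : Matrix (Fin N) (Fin N) ℂ) (g : SUN N) :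
    |(D * (g : Matrix (Fin N) (Fin N) ℂ)).trace.im| ≤ Real.sqrt N * frobNorm D := by
  refine (abs_im_trace_mul_le _ _).trans ?_
  rw [frobNorm_su, mul_comm]

/-! ### The Parseval closed form of `∑_α Re tr(Y_α P) Re tr(Y_α M)` -/

/-- **Bilinear Parseval identity of the frame**: for all complex matrices `P, M`,
`∑_α Re tr(Y_α P) · Re tr(Y_α M) = −½ Re tr(P M) + ½ Re tr(P Mᴴ) − (1/N) Im tr P · Im tr M`
(the frame `(Y_α)` is a Parseval frame of `𝔰𝔲(N)`; the last term is the trace constraint). [folklore] -/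
theorem sum_re_trace_frame_mul_mul (hN : N ≠ 0) (P M : Matrix (Fin N) (Fin N) ℂ) :
    ∑ α, (frame α * P).trace.re * (frame α * M).trace.re =
      -(1 / 2) * (P * M).trace.re + (1 / 2) * (P * Mᴴ).trace.re - (1 / N) * P.trace.im * M.trace.im := by
  set X : Matrix (Fin N) (Fin N) ℂ := P - Pᴴ with hX
  set X' : Matrix (Fin N) (Fin N) ℂ := M - Mᴴ with hX'
  -- the complex identity `∑ tr(Y X) tr(Y X') = -tr(X X') + tr X tr X' / N`
  have hc : ∑ α, (frame α * X).trace * (frame α * X').trace = -(X * X').trace + X.trace / N * X'.trace := by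
    have h := congrArg (fun A => (A * X').trace) (sum_trace_mul_smul_frame hN X)
    simp only [sum_mul, trace_sum, smul_mul_assoc, trace_smul, smul_eq_mul, Matrix.add_mul, Matrix.neg_mul,
      trace_add, trace_neg, Matrix.one_mul] at h
    exact h
  -- each factor is twice a real part
  have h2 : ∀ α : FrameIdx N, (frame α * X).trace * (frame α * X').trace =
      (4 : ℂ) * ((((frame α * P).trace.re * (frame α * M).trace.re : ℝ)) : ℂ) := by
    intro α
    rw [hX, hX', ← two_mul_re_trace_eq (frame_conjTranspose α) P, ← two_mul_re_trace_eq (frame_conjTranspose α) M,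
      Complex.ofReal_mul]
    ring
  have hlhs : ((4 * ∑ α, (frame α * P).trace.re * (frame α * M).trace.re : ℝ) : ℂ) =
      -(X * X').trace + X.trace / N * X'.trace := by
    rw [← hc, Complex.ofReal_mul, Complex.ofReal_sum, mul_sum]
    refine sum_congr rfl fun α _ => ?_
    rw [h2]; norm_num
  -- evaluate the right-hand side
  have hPM : (Pᴴ * Mᴴ).trace = conj ((P * M).trace) := by
    rw [← conjTranspose_mul, trace_conjTranspose, trace_mul_comm, star_def]
  have hPM' : (Pᴴ * M).trace = conj ((P * Mᴴ).trace) := by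
    have : Pᴴ * M = (Mᴴ * P)ᴴ := by rw [conjTranspose_mul, conjTranspose_conjTranspose]
    rw [this, trace_conjTranspose, trace_mul_comm, star_def]
  have hXX : (X * X').trace = 2 * (((P * M).trace.re : ℝ) : ℂ) - 2 * (((P * Mᴴ).trace.re : ℝ) : ℂ) := by
    rw [hX, hX', Matrix.sub_mul, Matrix.mul_sub, Matrix.mul_sub, trace_sub, trace_sub, trace_sub, hPM, hPM']
    apply Complex.ext
    · simp [Complex.conj_re]; ring
    · simp [Complex.conj_im]; ring
  have htrX : X.trace = 2 * ((P.trace.im : ℝ) : ℂ) * I := by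
    rw [hX, trace_sub, trace_conjTranspose, star_def, sub_conj]; push_cast; ring
  have htrX' : X'.trace = 2 * ((M.trace.im : ℝ) : ℂ) * I := by
    rw [hX', trace_sub, trace_conjTranspose, star_def, sub_conj]; push_cast; ring
  have hrhs : -(X * X').trace + X.trace / N * X'.trace =
      ((4 * (-(1 / 2) * (P * M).trace.re + (1 / 2) * (P * Mᴴ).trace.re - (1 / N) * P.trace.im * M.trace.im) : ℝ) : ℂ) := by
    rw [hXX, htrX, htrX', mul_assoc (2 : ℂ) _ I, mul_div_assoc, mul_assoc (2 : ℂ) ((M.trace.im : ℝ) : ℂ) I]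
    have hN' : (N : ℂ) ≠ 0 := Nat.cast_ne_zero.2 hN
    have e : (2 : ℂ) * ((((P.trace.im : ℝ) : ℂ) * I) / N) * (2 * (((M.trace.im : ℝ) : ℂ) * I)) =
        -(4 / N * (((P.trace.im : ℝ) : ℂ) * ((M.trace.im : ℝ) : ℂ))) := by
      field_simp
      linear_combination ((4 : ℂ) * (P.trace.im : ℂ) * (M.trace.im : ℂ)) * I_mul_I
    rw [e]
    push_cast
    ring
  have h := hlhs.trans hrhs
  have h' := Complex.ofReal_injective h
  linarith

/-! ### The carré du champ of two linear observables -/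

/-- **`Γ(c Re tr(· B), c' Re tr(· D))(Q) = c c' (−½ Re tr(B Q D Q) + ½ Re tr(B Q (D Q)ᴴ) − (1/N) Im tr(BQ) Im tr(DQ))`**
for every complex matrix `Q` (ambient identity; on `SU(N)` the middle term is the constant `½ Re tr(B Dᴴ)`). [folklore] -/
theorem Gam_pot_pot (hN : N ≠ 0) (c c' : ℝ) (B D Q : Matrix (Fin N) (Fin N) ℂ) :
    Gam (pot c B) (pot c' D) Q =
      c * c' * (-(1 / 2) * (B * Q * D * Q).trace.re + (1 / 2) * (B * Q * (D * Q)ᴴ).trace.re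
        - (1 / N) * (B * Q).trace.im * (D * Q).trace.im) := by
  have hB : pot (N := N) c B = fun Q => c * (Q * B).trace.re := rfl
  have hD : pot (N := N) c' D = fun Q => c' * (Q * D).trace.re := rfl
  have h1 : ∀ α : FrameIdx N, matD (frame α) (pot c B) Q = c * (frame α * (B * Q)).trace.re := by
    intro α
    rw [hB, matD_const_mul_reTrMul]
    show c * (Q * frame α * B).trace.re = _
    rw [Matrix.mul_assoc, trace_mul_comm, Matrix.mul_assoc]
  have h2 : ∀ α : FrameIdx N, matD (frame α) (pot c' D) Q = c' * (frame α * (D * Q)).trace.re := by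
    intro α
    rw [hD, matD_const_mul_reTrMul]
    show c' * (Q * frame α * D).trace.re = _
    rw [Matrix.mul_assoc, trace_mul_comm, Matrix.mul_assoc]
  show ∑ α, matD (frame α) (pot c B) Q * matD (frame α) (pot c' D) Q = _
  simp_rw [h1, h2]
  have h3 : ∑ α, c * (frame α * (B * Q)).trace.re * (c' * (frame α * (D * Q)).trace.re) =
      c * c' * ∑ α, (frame α * (B * Q)).trace.re * (frame α * (D * Q)).trace.re := by
    rw [mul_sum]; refine sum_congr rfl fun α _ => ?_; ring
  rw [h3, sum_re_trace_frame_mul_mul hN]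
  simp only [Matrix.mul_assoc]

/-- On `SU(N)` the middle term is constant: `B g (D g)ᴴ = B Dᴴ`. [folklore] -/
theorem mul_su_mul_conjTranspose (B D : Matrix (Fin N) (Fin N) ℂ) (g : SUN N) :
    B * (g : Matrix (Fin N) (Fin N) ℂ) * (D * (g : Matrix (Fin N) (Fin N) ℂ))ᴴ = B * Dᴴ := by
  have hg : (g : Matrix (Fin N) (Fin N) ℂ) * (g : Matrix (Fin N) (Fin N) ℂ)ᴴ = 1 := by
    rw [← star_eq_conjTranspose]; exact Matrix.mem_unitaryGroup_iff.1 (SUN.mem_unitaryGroup g)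
  rw [conjTranspose_mul, Matrix.mul_assoc, ← Matrix.mul_assoc (g : Matrix (Fin N) (Fin N) ℂ), hg, Matrix.one_mul]

/-- **The carré du champ of two linear observables on `SU(N)`**:
`Γ(c Re tr(· B), c' Re tr(· D))(g) = c c' (−½ Re tr(B g D g) + ½ Re tr(B Dᴴ) − (1/N) Im tr(B g) Im tr(D g))`. [folklore] -/
theorem Gam_pot_pot_su (hN : N ≠ 0) (c c' : ℝ) (B D : Matrix (Fin N) (Fin N) ℂ) (g : SUN N) :
    Gam (pot c B) (pot c' D) g =
      c * c' * (-(1 / 2) * (B * g * D * g).trace.re + (1 / 2) * (B * Dᴴ).trace.re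
        - (1 / N) * (B * (g : Matrix (Fin N) (Fin N) ℂ)).trace.im * (D * (g : Matrix (Fin N) (Fin N) ℂ)).trace.im) := by
  rw [Gam_pot_pot hN, mul_su_mul_conjTranspose]

/-- **`Γ(Re tr(· D), Re tr(· D)) ≤ ‖D‖_F²` on `SU(N)`** (Bessel for the Parseval frame; no Lipschitz machinery needed).
[folklore] -/
theorem Gam_pot_one_self_le (hN : N ≠ 0) (D : Matrix (Fin N) (Fin N) ℂ) (g : SUN N) :
    Gam (pot 1 D) (pot 1 D) g ≤ frobNorm D ^ 2 := by
  rw [Gam_pot_pot hN, one_mul, one_mul]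
  set P : Matrix (Fin N) (Fin N) ℂ := D * (g : Matrix (Fin N) (Fin N) ℂ) with hP
  have hPF : frobNorm P = frobNorm D := by rw [hP, frobNorm_mul_unitary _ (SUN.mem_unitaryGroup g)]
  have h1 : -(frobNorm D * frobNorm D) ≤ (D * g * D * g).trace.re := by
    have h := abs_re_trace_mul_le P P
    rw [hPF, hP, ← Matrix.mul_assoc] at h
    exact (abs_le.1 h).1
  have h2 : (D * g * Pᴴ).trace.re = frobNorm D ^ 2 := by
    rw [← hPF, frobNorm_sq_eq_re_trace, ← hP, trace_mul_comm]
  have h3 : 0 ≤ (1 / (N : ℝ)) * (P.trace.im * P.trace.im) := mul_nonneg (by positivity) (mul_self_nonneg _)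
  rw [h2]
  nlinarith [h1, h3]

/-! ### The quadratic trace polynomial `γ` and its Lipschitz constant on `SU(N)` -/

/-- The quadratic word: `|Re tr(B a D a) − Re tr(B b D b)| ≤ 2 ‖B‖_op ‖D‖_F ‖a − b‖_F` on `SU(N)`. [folklore] -/
theorem abs_re_trace_word_sub_le (B D : Matrix (Fin N) (Fin N) ℂ) (a b : SUN N) :
    |(B * a * D * a).trace.re - (B * b * D * b).trace.re| ≤ 2 * matrixOpNorm B * frobNorm D * suFrobDist a b := by
  set A : Matrix (Fin N) (Fin N) ℂ := (a : Matrix (Fin N) (Fin N) ℂ) with hA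
  set A' : Matrix (Fin N) (Fin N) ℂ := (b : Matrix (Fin N) (Fin N) ℂ) with hA'
  -- cyclic rearrangements under the trace
  have hdiff : (B * A * D * A).trace.re - (B * A' * D * A').trace.re =
      ((A - A') * (D * A * B)).trace.re + ((A - A') * (B * A' * D)).trace.re := by
    have e1 : B * A * D * A - B * A' * D * A' = B * (A - A') * D * A + B * A' * D * (A - A') := by noncomm_ring
    have e2 : (B * (A - A') * D * A).trace = ((A - A') * (D * A * B)).trace := by
      rw [show B * (A - A') * D * A = B * ((A - A') * (D * A)) by simp only [Matrix.mul_assoc], trace_mul_comm,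
        Matrix.mul_assoc]
    have e3 : (B * A' * D * (A - A')).trace = ((A - A') * (B * A' * D)).trace := trace_mul_comm _ _
    rw [← Complex.sub_re, ← trace_sub, e1, trace_add, e2, e3, Complex.add_re]
  rw [hdiff]
  have hB0 := matrixOpNorm_nonneg B
  have t1 : |((A - A') * (D * A * B)).trace.re| ≤ suFrobDist a b * (frobNorm D * matrixOpNorm B) := by
    refine (abs_re_trace_mul_le _ _).trans (mul_le_mul_of_nonneg_left ?_ (frobNorm_nonneg _))
    calc frobNorm (D * A * B) ≤ frobNorm (D * A) * matrixOpNorm B := frobNorm_mul_le_mul_matrixOpNorm _ _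
      _ = frobNorm D * matrixOpNorm B := by rw [hA, frobNorm_mul_unitary _ (SUN.mem_unitaryGroup a)]
  have t2 : |((A - A') * (B * A' * D)).trace.re| ≤ suFrobDist a b * (matrixOpNorm B * frobNorm D) := by
    refine (abs_re_trace_mul_le _ _).trans (mul_le_mul_of_nonneg_left ?_ (frobNorm_nonneg _))
    calc frobNorm (B * A' * D) = frobNorm (B * (A' * D)) := by rw [Matrix.mul_assoc]
      _ ≤ matrixOpNorm B * frobNorm (A' * D) := frobNorm_mul_le_matrixOpNorm_mul _ _
      _ = matrixOpNorm B * frobNorm D := by rw [hA', frobNorm_unitary_mul (SUN.mem_unitaryGroup b)]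
  calc |((A - A') * (D * A * B)).trace.re + ((A - A') * (B * A' * D)).trace.re|
      ≤ |((A - A') * (D * A * B)).trace.re| + |((A - A') * (B * A' * D)).trace.re| := abs_add_le _ _
    _ ≤ suFrobDist a b * (frobNorm D * matrixOpNorm B) + suFrobDist a b * (matrixOpNorm B * frobNorm D) := add_le_add t1 t2
    _ = 2 * matrixOpNorm B * frobNorm D * suFrobDist a b := by ring

/-- The trace–trace term: `|Im tr(B a) Im tr(D a) − Im tr(B b) Im tr(D b)| ≤ 2 N ‖B‖_op ‖D‖_F ‖a − b‖_F` on `SU(N)`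
(`‖B‖_F ≤ √N ‖B‖_op`, `‖g‖_F = √N`). [folklore] -/
theorem abs_im_trace_mul_im_trace_sub_le (B D : Matrix (Fin N) (Fin N) ℂ) (a b : SUN N) :
    |(B * (a : Matrix (Fin N) (Fin N) ℂ)).trace.im * (D * (a : Matrix (Fin N) (Fin N) ℂ)).trace.im -
        (B * (b : Matrix (Fin N) (Fin N) ℂ)).trace.im * (D * (b : Matrix (Fin N) (Fin N) ℂ)).trace.im| ≤
      2 * N * matrixOpNorm B * frobNorm D * suFrobDist a b := by
  set A : Matrix (Fin N) (Fin N) ℂ := (a : Matrix (Fin N) (Fin N) ℂ) with hA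
  set A' : Matrix (Fin N) (Fin N) ℂ := (b : Matrix (Fin N) (Fin N) ℂ) with hA'
  have hsplit : (B * A).trace.im * (D * A).trace.im - (B * A').trace.im * (D * A').trace.im =
      (B * (A - A')).trace.im * (D * A).trace.im + (B * A').trace.im * (D * (A - A')).trace.im := by
    rw [Matrix.mul_sub, Matrix.mul_sub, trace_sub, trace_sub, Complex.sub_im, Complex.sub_im]; ring
  rw [hsplit]
  have hN0 : (0 : ℝ) ≤ N := Nat.cast_nonneg N
  have hsq : Real.sqrt N * Real.sqrt N = N := Real.mul_self_sqrt hN0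
  have hB0 := matrixOpNorm_nonneg B
  have hD0 := frobNorm_nonneg D
  have hab := suFrobDist_nonneg a b
  have e1 : |(B * (A - A')).trace.im| ≤ Real.sqrt N * matrixOpNorm B * suFrobDist a b := by
    refine (abs_im_trace_mul_le _ _).trans ?_
    exact mul_le_mul_of_nonneg_right (frobNorm_le_sqrt_mul_matrixOpNorm B) (frobNorm_nonneg _)
  have e2 : |(D * A).trace.im| ≤ Real.sqrt N * frobNorm D := abs_im_trace_mul_su_le' D a
  have e3 : |(B * A').trace.im| ≤ N * matrixOpNorm B := abs_im_trace_mul_su_le B b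
  have e4 : |(D * (A - A')).trace.im| ≤ frobNorm D * suFrobDist a b := abs_im_trace_mul_le _ _
  calc |(B * (A - A')).trace.im * (D * A).trace.im + (B * A').trace.im * (D * (A - A')).trace.im|
      ≤ |(B * (A - A')).trace.im| * |(D * A).trace.im| + |(B * A').trace.im| * |(D * (A - A')).trace.im| := by
        refine (abs_add_le _ _).trans ?_; rw [abs_mul, abs_mul]
    _ ≤ (Real.sqrt N * matrixOpNorm B * suFrobDist a b) * (Real.sqrt N * frobNorm D) +
          (N * matrixOpNorm B) * (frobNorm D * suFrobDist a b) :=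
        add_le_add (mul_le_mul e1 e2 (abs_nonneg _) (by positivity)) (mul_le_mul e3 e4 (abs_nonneg _) (by positivity))
    _ = 2 * N * matrixOpNorm B * frobNorm D * suFrobDist a b := by
        have : Real.sqrt N * matrixOpNorm B * suFrobDist a b * (Real.sqrt N * frobNorm D) =
            (Real.sqrt N * Real.sqrt N) * matrixOpNorm B * frobNorm D * suFrobDist a b := by ring
        rw [this, hsq]; ring

/-- **Lipschitz constant of the quadratic trace polynomial `γ` on `SU(N)`, uniform in `N`**: for
`γ(g) = −½ Re tr(B g D g) − (1/N) Im tr(B g) Im tr(D g)`,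
`|γ(a) − γ(b)| ≤ 3 ‖B‖_op ‖D‖_F ‖a − b‖_F`. [folklore] -/
theorem abs_gamma_sub_le (hN : N ≠ 0) (B D : Matrix (Fin N) (Fin N) ℂ) (a b : SUN N) :
    |(-(1 / 2) * (B * a * D * a).trace.re
        - (1 / N) * (B * (a : Matrix (Fin N) (Fin N) ℂ)).trace.im * (D * (a : Matrix (Fin N) (Fin N) ℂ)).trace.im) -
      (-(1 / 2) * (B * b * D * b).trace.re
        - (1 / N) * (B * (b : Matrix (Fin N) (Fin N) ℂ)).trace.im * (D * (b : Matrix (Fin N) (Fin N) ℂ)).trace.im)| ≤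
      3 * matrixOpNorm B * frobNorm D * suFrobDist a b := by
  have hN0 : (0 : ℝ) < N := Nat.cast_pos.2 (Nat.pos_of_ne_zero hN)
  have h1 := abs_re_trace_word_sub_le B D a b
  have h2 := abs_im_trace_mul_im_trace_sub_le B D a b
  have e : (-(1 / 2) * (B * a * D * a).trace.re
        - (1 / N) * (B * (a : Matrix (Fin N) (Fin N) ℂ)).trace.im * (D * (a : Matrix (Fin N) (Fin N) ℂ)).trace.im) -
      (-(1 / 2) * (B * b * D * b).trace.re
        - (1 / N) * (B * (b : Matrix (Fin N) (Fin N) ℂ)).trace.im * (D * (b : Matrix (Fin N) (Fin N) ℂ)).trace.im) =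
      -(1 / 2) * ((B * a * D * a).trace.re - (B * b * D * b).trace.re) -
        (1 / N) * ((B * (a : Matrix (Fin N) (Fin N) ℂ)).trace.im * (D * (a : Matrix (Fin N) (Fin N) ℂ)).trace.im -
          (B * (b : Matrix (Fin N) (Fin N) ℂ)).trace.im * (D * (b : Matrix (Fin N) (Fin N) ℂ)).trace.im) := by ring
  rw [e]
  refine (abs_sub _ _).trans ?_
  rw [abs_mul, abs_mul, abs_neg, abs_of_pos (by norm_num : (0 : ℝ) < 1 / 2), abs_of_pos (by positivity : (0 : ℝ) < 1 / N)]
  calc 1 / 2 * |(B * a * D * a).trace.re - (B * b * D * b).trace.re| +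
        1 / N * |(B * (a : Matrix (Fin N) (Fin N) ℂ)).trace.im * (D * (a : Matrix (Fin N) (Fin N) ℂ)).trace.im -
          (B * (b : Matrix (Fin N) (Fin N) ℂ)).trace.im * (D * (b : Matrix (Fin N) (Fin N) ℂ)).trace.im|
      ≤ 1 / 2 * (2 * matrixOpNorm B * frobNorm D * suFrobDist a b) +
          1 / N * (2 * N * matrixOpNorm B * frobNorm D * suFrobDist a b) :=
        add_le_add (mul_le_mul_of_nonneg_left h1 (by norm_num)) (mul_le_mul_of_nonneg_left h2 (by positivity))
    _ = 3 * matrixOpNorm B * frobNorm D * suFrobDist a b := by field_simp; ring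

/-! ### The Laplacian-eigenfunction identity for linear observables -/

/-- **`Δ Re tr(· M) = −(N − 1/N) Re tr(· M)`**: linear observables (matrix coefficients of the fundamental representation)
are eigenfunctions of the Laplace–Beltrami operator of `SU(N)` with eigenvalue the Casimir `N − 1/N` (ambient identity,
`∑_α Y_α² = −(N − 1/N) 1`). [folklore] -/
theorem Lap_reTrMul (hN : N ≠ 0) (M : Matrix (Fin N) (Fin N) ℂ) :
    Lap (fun Q : Matrix (Fin N) (Fin N) ℂ => (Q * M).trace.re) =
      fun Q => -(((N : ℝ) - 1 / N) * (Q * M).trace.re) := by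
  funext Q
  have h1 : ∀ α : FrameIdx N, matD (frame α) (matD (frame α) (fun Q : Matrix (Fin N) (Fin N) ℂ => (Q * M).trace.re)) Q =
      (Q * (frame α * frame α) * M).trace.re := by
    intro α
    have e : (fun Q : Matrix (Fin N) (Fin N) ℂ => (Q * frame α * M).trace.re) =
        fun Q => (Q * (frame α * M)).trace.re := by
      funext Q; rw [Matrix.mul_assoc]
    rw [matD_reTrMul, e, matD_reTrMul]
    simp only [Matrix.mul_assoc]
  show ∑ α, matD (frame α) (matD (frame α) (fun Q : Matrix (Fin N) (Fin N) ℂ => (Q * M).trace.re)) Q = _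
  simp_rw [h1]
  rw [← Complex.re_sum, ← trace_sum, ← sum_mul, ← mul_sum, sum_frame_mul_frame hN]
  have hc : ((N : ℂ) - 1 / N) = (((N : ℝ) - 1 / N : ℝ) : ℂ) := by push_cast; rfl
  rw [hc, Matrix.mul_neg, Matrix.neg_mul, trace_neg, Matrix.mul_smul, Matrix.smul_mul, trace_smul, Matrix.mul_one,
    Complex.neg_re, smul_eq_mul, Complex.re_ofReal_mul]

/-- The eigenfunction identity for the potential-type observable `pot c M = c Re tr(· M)`. [folklore] -/
theorem Lap_pot (hN : N ≠ 0) (c : ℝ) (M : Matrix (Fin N) (Fin N) ℂ) :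
    Lap (pot c M) = fun Q => -(((N : ℝ) - 1 / N) * pot c M Q) := by
  have h : pot (N := N) c M = fun Q => c * (Q * M).trace.re := rfl
  have hs : pot (N := N) c M = c • fun Q : Matrix (Fin N) (Fin N) ℂ => (Q * M).trace.re := by
    funext Q; rfl
  rw [hs, Lap_smul c (contDiff_reTrMul M), Lap_reTrMul hN]
  funext Q
  simp only [Pi.smul_apply, smul_eq_mul]
  ring

/-- **`u = (Γ(S,u) − L_S u)/λ`** for `u = pot c M`, any smooth weight `S`, `λ = N − 1/N`:
the first-order Poisson representation of a linear observable. [folklore] -/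
theorem pot_eq_Gam_sub_genL (hN : 2 ≤ N) (S : Matrix (Fin N) (Fin N) ℂ → ℝ) (c : ℝ) (M Q : Matrix (Fin N) (Fin N) ℂ) :
    pot c M Q = (Gam S (pot c M) Q - genL S (pot c M) Q) / ((N : ℝ) - 1 / N) := by
  have hN0 : N ≠ 0 := by omega
  have hl : (0 : ℝ) < (N : ℝ) - 1 / N := by
    have h2 : (2 : ℝ) ≤ N := by exact_mod_cast hN
    have : (1 : ℝ) / N ≤ 1 / 2 := by
      rw [div_le_div_iff₀ (by positivity) (by norm_num)]; linarith
    linarith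
  have hL := congrFun (Lap_pot hN0 c M) Q
  rw [eq_div_iff hl.ne']
  simp only [genL, hL]
  ring

end Summit.Ventures.YMGap.OneLinkEigen
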